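import Mathlib
import HarnessLib
import Summits.HubbardSuperconductivity.HubbardSuperconductivity.Theorems.ComplexGFFStiffnessHypACumulantTiltLinear
import Summits.HubbardSuperconductivity.HubbardSuperconductivity.Theorems.ComplexGFFStiffnessHypACumulantZOfGNV
import Summits.HubbardSuperconductivity.HubbardSuperconductivity.Theorems.ComplexGFFStiffnessHypALocalTwoPointPertKLinear

/-!
# Crux `HypACumulant`, line `gnv` — weighted `C^{r₀}` derivative bounds for the pieces of the linear tilt
# `𝒦ˡ_{g,t} = 𝒦_g + t·Q_u·(1 + 𝒦_g)`

Route `route-HubbardSuperconductivity-ComplexGFFStiffness`, crux item stmt-HubbardSuperconductivity-19154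
(`HypACumulant`), registered stub `stub_cumulantGivenZ : CumulantGivenZ`.  Part 3a of the reduction of that stub
to `OnePointLipschitz` (parts 1, 2: `…HypACumulantTiltMoments`, `…HypACumulantTiltLinear`; part 3b:
`…HypACumulantOfOnePointLipschitz`): the elementary real-analysis estimates.

* `tiltQ_eq_multilinear_comp`, `norm_iteratedFDeriv_tiltQ_le`, `norm_iteratedFDeriv_tiltQ_ofReal_le` —
  `Q_u = M_u ∘ Δ` for a bilinear form of norm `≤ 9‖u‖` (cf. `berryVertex_eq_multilinear_comp`), hence
  `‖D^i Q_u(z)‖ ≤ 18‖u‖(1+‖z‖)²` for every order `i`;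
* `norm_iteratedFDeriv_one_add_pertK_le` — `‖D^m (1+𝒦_g)(z)‖ ≤ m!·18^m·(1+‖z‖)^{2m}` for `0 ≤ g ≤ 1`
  (from `norm_iteratedFDeriv_pertK_one_le` and the scaling `norm_iteratedFDeriv_pertK_le_scaled`);
* `norm_iteratedFDeriv_tiltQ_mul_le` — Leibniz: `‖D^k (Q_u·(1+𝒦_g))(z)‖ ≤ ‖u‖·(18·k!·36^k)·(1+‖z‖)^{2k+2}`;
* `one_add_norm_pow_le_exp_sum_sq` — `(1+‖z‖)^m ≤ C_m e^{Σ_i z_i²/8}` (from the sibling crux's `one_add_pow_le_exp_eighth`)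
  (the Gaussian weight of `IsIotaAdmissibleWt r₀ (1/8)`).

All proved, no `sorry`; nothing here is specific to the volume or bears on the Hubbard model.

## References
* S. Adams, S. Buchholz, R. Kotecký, S. Müller, arXiv:1910.13564, Sec. 2.1 (the weighted `C^{r₀}` space
  `E_{ζ,𝒬}`) [AdamsBuchholzKoteckyMuller2019].
-/

noncomputable section

-- `Summit.<Summit>.<Problem>`: single-conjunct summit, the duplicate component is mandated (D-0017).
set_option linter.dupNamespace false

namespace Summit.HubbardSuperconductivity.HubbardSuperconductivity.Theorems.ComplexGFF

open scoped BigOperators ComplexConjugate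
open MeasureTheory
open Literature.MathematicalPhysics.StatisticalMechanics.ComplexGradientGFF4 (Z ev Y D S X w)

/-! ### `Q_u` through a bilinear form: smoothness and derivative bounds -/

/-- `Q_u = M_u ∘ Δ` for a bilinear form `M_u` on `(ℝ⁴)²` of norm `≤ 9‖u‖` and the diagonal `Δ(z) = (z,z)`
(norm `≤ 1`, isometric on vectors). -/
theorem tiltQ_eq_multilinear_comp (u : Fin 4 → ℝ) :
    ∃ (M : ContinuousMultilinearMap ℝ (fun _ : Fin 2 => (Fin 4 → ℝ)) ℝ)
      (T : (Fin 4 → ℝ) →L[ℝ] (Fin 2 → (Fin 4 → ℝ))),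
      ‖M‖ ≤ 9 * ‖u‖ ∧ ‖T‖ ≤ 1 ∧ (∀ z, ‖T z‖ = ‖z‖) ∧ tiltQ u = (fun v => M v) ∘ (fun z => T z) := by
  classical
  -- elementary bilinear monomials `v ↦ (v 0)_a (v 1)_b`
  let mono : Fin 4 → Fin 4 → ContinuousMultilinearMap ℝ (fun _ : Fin 2 => (Fin 4 → ℝ)) ℝ := fun a b =>
    (ContinuousMultilinearMap.mkPiAlgebraFin ℝ 2 ℝ).compContinuousLinearMap
      (fun i : Fin 2 => ContinuousLinearMap.proj (R := ℝ) (φ := fun _ : Fin 4 => ℝ) (if i = 0 then a else b))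
  let M : ContinuousMultilinearMap ℝ (fun _ : Fin 2 => (Fin 4 → ℝ)) ℝ :=
    ∑ j : Fin 3, (u 0 • mono j.succ j.succ + (2 * u j.succ) • mono 0 j.succ)
  let T : (Fin 4 → ℝ) →L[ℝ] (Fin 2 → (Fin 4 → ℝ)) :=
    ContinuousLinearMap.pi (fun _ : Fin 2 => ContinuousLinearMap.id ℝ (Fin 4 → ℝ))
  have hT_apply : ∀ z, T z = fun _ => z := fun z => rfl
  have hT_norm : ∀ z, ‖T z‖ = ‖z‖ := fun z => by rw [hT_apply]; exact pi_norm_const z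
  have hmono_apply : ∀ a b (v : Fin 2 → (Fin 4 → ℝ)), mono a b v = v 0 a * v 1 b := by
    intro a b v
    simp [mono]
  have hM_apply : ∀ v : Fin 2 → (Fin 4 → ℝ),
      M v = ∑ j : Fin 3, (u 0 * (v 0 j.succ * v 1 j.succ) + 2 * u j.succ * (v 0 0 * v 1 j.succ)) := by
    intro v
    simp [M, hmono_apply]
  have hproj : ∀ k : Fin 4, ‖ContinuousLinearMap.proj (R := ℝ) (φ := fun _ : Fin 4 => ℝ) k‖ ≤ 1 :=
    fun k => ContinuousLinearMap.opNorm_le_bound _ zero_le_one (fun z => by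
      rw [one_mul, ContinuousLinearMap.proj_apply]
      exact norm_le_pi_norm z k)
  have hmono : ∀ a b, ‖mono a b‖ ≤ 1 := by
    intro a b
    refine le_trans (ContinuousMultilinearMap.norm_compContinuousLinearMap_le _ _) ?_
    rw [ContinuousMultilinearMap.norm_mkPiAlgebraFin, one_mul]
    exact Finset.prod_le_one (fun i _ => norm_nonneg _) (fun i _ => hproj _)
  have hu : ∀ i, |u i| ≤ ‖u‖ := fun i => by
    have h := norm_le_pi_norm u i
    rwa [Real.norm_eq_abs] at h
  refine ⟨M, T, ?_, ?_, hT_norm, ?_⟩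
  · refine le_trans (norm_sum_le _ _) ?_
    have h : ∀ j ∈ (Finset.univ : Finset (Fin 3)),
        ‖u 0 • mono j.succ j.succ + (2 * u j.succ) • mono 0 j.succ‖ ≤ 3 * ‖u‖ := by
      intro j _
      refine le_trans (norm_add_le _ _) ?_
      rw [norm_smul, norm_smul, Real.norm_eq_abs, Real.norm_eq_abs, abs_mul, abs_two]
      calc |u 0| * ‖mono j.succ j.succ‖ + 2 * |u j.succ| * ‖mono 0 j.succ‖
          ≤ ‖u‖ * 1 + 2 * ‖u‖ * 1 := by
            gcongr
            · exact hu 0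
            · exact hmono _ _
            · exact hu _
            · exact hmono _ _
        _ = 3 * ‖u‖ := by ring
    refine le_trans (Finset.sum_le_sum h) ?_
    simp only [Finset.sum_const, Finset.card_univ, Fintype.card_fin, nsmul_eq_mul, Nat.cast_ofNat]
    linarith [norm_nonneg u]
  · exact ContinuousLinearMap.opNorm_le_bound _ zero_le_one (fun z => by rw [hT_norm, one_mul])
  · funext z
    rw [Function.comp_apply, hT_apply, hM_apply, tiltQ, Finset.mul_sum, Finset.mul_sum, ← Finset.sum_add_distrib]
    refine Finset.sum_congr rfl (fun j _ => ?_)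
    ring

/-- `Q_u` is smooth. -/
theorem contDiff_tiltQ {m : WithTop ℕ∞} (u : Fin 4 → ℝ) : ContDiff ℝ m (tiltQ u) := by
  obtain ⟨M, T, -, -, -, h⟩ := tiltQ_eq_multilinear_comp u
  rw [h]
  exact M.contDiff.comp T.contDiff

/-- `‖D^i Q_u(z)‖ ≤ 18‖u‖(1 + ‖z‖)²` for every `i`. -/
theorem norm_iteratedFDeriv_tiltQ_le (u : Fin 4 → ℝ) (i : ℕ) (z : Fin 4 → ℝ) :
    ‖iteratedFDeriv ℝ i (tiltQ u) z‖ ≤ 18 * ‖u‖ * (1 + ‖z‖) ^ 2 := by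
  obtain ⟨M, T, hM, hT, hTz, h⟩ := tiltQ_eq_multilinear_comp u
  rw [h, T.iteratedFDeriv_comp_right (M.contDiff (n := ⊤)) z (i := i) le_top]
  refine le_trans (ContinuousMultilinearMap.norm_compContinuousLinearMap_le _ _) ?_
  have h1 := M.norm_iteratedFDeriv_le i (T z)
  simp only [Fintype.card_fin] at h1
  rw [hTz] at h1
  have hprod : ∏ _k : Fin i, ‖T‖ ≤ 1 :=
    Finset.prod_le_one (fun _ _ => norm_nonneg _) (fun _ _ => hT)
  have hz : 0 ≤ ‖z‖ := norm_nonneg z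
  have hu0 : 0 ≤ ‖u‖ := norm_nonneg u
  have hdesc : (Nat.descFactorial 2 i : ℝ) ≤ 2 := by
    rcases le_or_gt i 2 with h | h
    · interval_cases i <;> norm_num [Nat.descFactorial]
    · rw [Nat.descFactorial_eq_zero_iff_lt.mpr h]; norm_num
  have hpow : ‖z‖ ^ (2 - i) ≤ (1 + ‖z‖) ^ 2 := by
    have h2i : 2 - i ≤ 2 := by omega
    calc ‖z‖ ^ (2 - i) ≤ (1 + ‖z‖) ^ (2 - i) := pow_le_pow_left₀ hz (by linarith) _
      _ ≤ (1 + ‖z‖) ^ 2 := pow_le_pow_right₀ (by linarith) h2i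
  have hA : ‖iteratedFDeriv ℝ i (fun v => M v) (T z)‖ ≤ 2 * (9 * ‖u‖) * (1 + ‖z‖) ^ 2 := by
    calc ‖iteratedFDeriv ℝ i (fun v => M v) (T z)‖
        ≤ (Nat.descFactorial 2 i : ℝ) * ‖M‖ * ‖z‖ ^ (2 - i) := h1
      _ ≤ 2 * (9 * ‖u‖) * (1 + ‖z‖) ^ 2 := by
          apply mul_le_mul (mul_le_mul hdesc hM (norm_nonneg _) (by norm_num)) hpow
            (pow_nonneg hz _) (by positivity)
  calc ‖iteratedFDeriv ℝ i (fun v => M v) (T z)‖ * ∏ _k : Fin i, ‖T‖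
      ≤ 2 * (9 * ‖u‖) * (1 + ‖z‖) ^ 2 * 1 :=
        mul_le_mul hA hprod (Finset.prod_nonneg (fun _ _ => norm_nonneg _)) (by positivity)
    _ = 18 * ‖u‖ * (1 + ‖z‖) ^ 2 := by ring

/-- The complexified `Q_u` is smooth. -/
theorem contDiff_tiltQ_ofReal {m : WithTop ℕ∞} (u : Fin 4 → ℝ) :
    ContDiff ℝ m (fun z : Fin 4 → ℝ => ((tiltQ u z : ℝ) : ℂ)) :=
  Complex.ofRealCLM.contDiff.comp (contDiff_tiltQ u)

/-- `‖D^i (Q_u : ℂ)(z)‖ ≤ 18‖u‖(1 + ‖z‖)²`. -/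
theorem norm_iteratedFDeriv_tiltQ_ofReal_le (u : Fin 4 → ℝ) (i : ℕ) (z : Fin 4 → ℝ) :
    ‖iteratedFDeriv ℝ i (fun z : Fin 4 → ℝ => ((tiltQ u z : ℝ) : ℂ)) z‖ ≤ 18 * ‖u‖ * (1 + ‖z‖) ^ 2 := by
  have h := Complex.ofRealLI.norm_iteratedFDeriv_comp_left (𝕜 := ℝ) ((contDiff_tiltQ (m := ⊤) u).contDiffAt (x := z))
    (i := i) le_top
  have e : (fun z : Fin 4 → ℝ => ((tiltQ u z : ℝ) : ℂ)) = Complex.ofRealLI ∘ tiltQ u := rfl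
  rw [e, h]
  exact norm_iteratedFDeriv_tiltQ_le u i z

/-! ### Derivative bounds for `1 + 𝒦_g = exp(−ig𝒜)` and for the direction `Q_u·(1 + 𝒦_g)` -/

/-- `1 + 𝒦_g` is smooth. -/
theorem contDiff_one_add_pertK {m : WithTop ℕ∞} (g : ℝ) : ContDiff ℝ m (fun z => 1 + pertK g z) :=
  contDiff_const.add (contDiff_pertK g)

/-- `‖D^m (1 + 𝒦_g)(z)‖ ≤ m!·18^m·(1 + ‖z‖)^{2m}` for `0 ≤ g ≤ 1`. -/
theorem norm_iteratedFDeriv_one_add_pertK_le {g : ℝ} (hg0 : 0 ≤ g) (hg1 : g ≤ 1) (m : ℕ) (z : Fin 4 → ℝ) :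
    ‖iteratedFDeriv ℝ m (fun z => 1 + pertK g z) z‖ ≤ (m.factorial : ℝ) * 18 ^ m * (1 + ‖z‖) ^ (2 * m) := by
  rcases Nat.eq_zero_or_pos m with hm | hm
  · subst hm
    rw [norm_iteratedFDeriv_zero]
    unfold pertK
    rw [add_sub_cancel, Complex.norm_exp]
    simp
  · have e : (fun z => 1 + pertK g z) = (fun _ => (1 : ℂ)) + pertK g := by funext z; simp
    rw [e, iteratedFDeriv_add contDiff_const (contDiff_pertK g), Pi.add_apply,
      iteratedFDeriv_const_of_ne (by omega : m ≠ 0), Pi.zero_apply, zero_add]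
    set c : ℝ := g ^ ((3 : ℝ)⁻¹) with hcdef
    have hc0 : 0 ≤ c := Real.rpow_nonneg hg0 _
    have hc1 : c ≤ 1 := Real.rpow_le_one hg0 hg1 (by norm_num)
    have hc3 : c ^ 3 = g := by
      have h := Real.rpow_inv_natCast_pow hg0 (n := 3) (by norm_num)
      simpa using h
    have hz : 0 ≤ ‖z‖ := norm_nonneg z
    have h := norm_iteratedFDeriv_pertK_le_scaled hc3 m z
    have h1 := norm_iteratedFDeriv_pertK_one_le hm (c • z)
    have hcz : ‖c • z‖ ≤ ‖z‖ := by
      rw [norm_smul, Real.norm_eq_abs, abs_of_nonneg hc0]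
      exact mul_le_of_le_one_left hz hc1
    have hck : |c| ^ m ≤ 1 := by
      rw [abs_of_nonneg hc0]
      exact pow_le_one₀ hc0 hc1
    have hpow : ((18 : ℝ) * (1 + ‖c • z‖) ^ 2) ^ m ≤ (18 * (1 + ‖z‖) ^ 2) ^ m :=
      pow_le_pow_left₀ (by positivity) (by gcongr) m
    calc ‖iteratedFDeriv ℝ m (pertK g) z‖
        ≤ ‖iteratedFDeriv ℝ m (pertK 1) (c • z)‖ * |c| ^ m := h
      _ ≤ ((m.factorial : ℝ) * (18 * (1 + ‖c • z‖) ^ 2) ^ m) * 1 :=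
          mul_le_mul h1 hck (pow_nonneg (abs_nonneg c) m) (by positivity)
      _ ≤ (m.factorial : ℝ) * (18 * (1 + ‖z‖) ^ 2) ^ m := by
          rw [mul_one]; exact mul_le_mul_of_nonneg_left hpow (by positivity)
      _ = (m.factorial : ℝ) * 18 ^ m * (1 + ‖z‖) ^ (2 * m) := by
          rw [mul_pow, ← pow_mul]; ring

/-- **Leibniz bound for the direction `Q_u·(1 + 𝒦_g)`:**
`‖D^k (Q_u·(1+𝒦_g))(z)‖ ≤ ‖u‖ · (18·k!·36^k) · (1 + ‖z‖)^{2k+2}` for `0 ≤ g ≤ 1`. -/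
theorem norm_iteratedFDeriv_tiltQ_mul_le {g : ℝ} (hg0 : 0 ≤ g) (hg1 : g ≤ 1) (u : Fin 4 → ℝ) (k : ℕ)
    (z : Fin 4 → ℝ) :
    ‖iteratedFDeriv ℝ k (fun z : Fin 4 → ℝ => ((tiltQ u z : ℝ) : ℂ) * (1 + pertK g z)) z‖
      ≤ ‖u‖ * (18 * k.factorial * 36 ^ k) * (1 + ‖z‖) ^ (2 * k + 2) := by
  have hz : 0 ≤ ‖z‖ := norm_nonneg z
  have hu0 : 0 ≤ ‖u‖ := norm_nonneg u
  have h1z : 1 ≤ 1 + ‖z‖ := by linarith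
  have hL := norm_iteratedFDeriv_mul_le (contDiff_tiltQ_ofReal (m := ⊤) u) (contDiff_one_add_pertK (m := ⊤) g) z
    (n := k) le_top
  refine le_trans hL ?_
  have hterm : ∀ i ∈ Finset.range (k + 1),
      (k.choose i : ℝ) * ‖iteratedFDeriv ℝ i (fun z : Fin 4 → ℝ => ((tiltQ u z : ℝ) : ℂ)) z‖ *
          ‖iteratedFDeriv ℝ (k - i) (fun z => 1 + pertK g z) z‖
        ≤ (k.choose i : ℝ) * (‖u‖ * (18 * k.factorial * 18 ^ k) * (1 + ‖z‖) ^ (2 * k + 2)) := by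
    intro i hi
    have hik : i ≤ k := Nat.lt_succ_iff.mp (Finset.mem_range.mp hi)
    have hA := norm_iteratedFDeriv_tiltQ_ofReal_le u i z
    have hB := norm_iteratedFDeriv_one_add_pertK_le hg0 hg1 (k - i) z
    have hfac : ((k - i).factorial : ℝ) ≤ k.factorial := by exact_mod_cast Nat.factorial_le (Nat.sub_le k i)
    have h18 : (18 : ℝ) ^ (k - i) ≤ 18 ^ k := pow_le_pow_right₀ (by norm_num) (Nat.sub_le k i)
    have hp : (1 + ‖z‖) ^ (2 * (k - i)) ≤ (1 + ‖z‖) ^ (2 * k) := pow_le_pow_right₀ h1z (by omega)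
    rw [mul_assoc]
    refine mul_le_mul_of_nonneg_left ?_ (by positivity)
    calc ‖iteratedFDeriv ℝ i (fun z : Fin 4 → ℝ => ((tiltQ u z : ℝ) : ℂ)) z‖ *
          ‖iteratedFDeriv ℝ (k - i) (fun z => 1 + pertK g z) z‖
        ≤ (18 * ‖u‖ * (1 + ‖z‖) ^ 2) * (((k - i).factorial : ℝ) * 18 ^ (k - i) * (1 + ‖z‖) ^ (2 * (k - i))) :=
          mul_le_mul hA hB (norm_nonneg _) (by positivity)
      _ ≤ (18 * ‖u‖ * (1 + ‖z‖) ^ 2) * ((k.factorial : ℝ) * 18 ^ k * (1 + ‖z‖) ^ (2 * k)) := by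
          gcongr
      _ = ‖u‖ * (18 * k.factorial * 18 ^ k) * (1 + ‖z‖) ^ (2 * k + 2) := by ring
  refine le_trans (Finset.sum_le_sum hterm) ?_
  rw [← Finset.sum_mul]
  have hchoose : ∑ i ∈ Finset.range (k + 1), (k.choose i : ℝ) = 2 ^ k := by
    have h := Nat.sum_range_choose k
    exact_mod_cast h
  rw [hchoose]
  have e : (2 : ℝ) ^ k * (‖u‖ * (18 * k.factorial * 18 ^ k) * (1 + ‖z‖) ^ (2 * k + 2))
      = ‖u‖ * (18 * k.factorial * (2 * 18) ^ k) * (1 + ‖z‖) ^ (2 * k + 2) := by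
    rw [mul_pow]; ring
  rw [e]
  norm_num

/-! ### Gaussian domination of polynomial weights (`one_add_pow_le_exp_eighth` of `…HypALocalTwoPointPertKLinear`) -/

/-- `(1 + ‖z‖)^m ≤ C_m · exp(Σ_i z_i²/8)` with the constant of `one_add_pow_le_exp_eighth`. -/
theorem one_add_norm_pow_le_exp_sum_sq (m : ℕ) :
    ∃ C : ℝ, 0 < C ∧ ∀ z : Fin 4 → ℝ, (1 + ‖z‖) ^ m ≤ C * Real.exp ((1 / 8 : ℝ) * ∑ i : Fin 4, (z i) ^ 2) := by
  obtain ⟨C, hC, hCle⟩ := one_add_pow_le_exp_eighth m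
  refine ⟨C, hC, fun z => le_trans (hCle ‖z‖ (norm_nonneg z)) (mul_le_mul_of_nonneg_left ?_ hC.le)⟩
  exact Real.exp_le_exp.mpr (by linarith [norm_sq_le_sum_sq z])


end Summit.HubbardSuperconductivity.HubbardSuperconductivity.Theorems.ComplexGFF

end
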